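import Summits.ValiantsHypothesis.ValiantsHypothesis.Theorems.LacunarySymmetroidMatrixDescartesWLawTwoSignCell

/-!
# `MatrixDescartes` (stmt-ValiantsHypothesis-18050) — the W-law at `n = 2` holds in the WITNESS CLASS:
# a rank-one middle letter gives `Z₊ ≤ 6` in every exponent chamber

HONEST FRAMING.  Cell `pub-symmetroid`, seat `val-sym-mdr-p2` (gen 6); helper `--supports` the crux
`Theses.LacunarySymmetroid.MatrixDescartes` (OPEN), NO closure claim.  Object: the typed W-law `WLawAt 2 6` of `…WLawDefs` for
`2 × 2` W-configurations `X^e J + X^{d₁} P₁ + X^{d₂} P₂ + X^{d₃} Q` (`d₂ < d₁ < e < d₃`, `J` symmetric, `P₁, P₂, Q ⪰ 0`).  The tree has: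
`Z₊ ≤ 6` off the exponent chamber `e + d₂ < 2d₁ ∧ d₁ + e < d₂ + d₃ ∧ d₂ + d₃ < 2e` (CHAMBER LAW, `…WLawTwoChambers`, val-sym-mdr-p1 g4) and
off the sign cell `det J < 0 ∧ mix(J,·) < 0` (SIGN-CELL LAW, `…WLawTwoSignCell`, this seat).  This file closes one more class, the one the
tree's six-root witness `WLawTwoWitness` belongs to (`P₁ = v vᵀ`):

* `coeff_two_d₁` — inside the chamber the coefficient of `X^{2d₁}` in the W-determinant is `det P₁` (the degree `2d₁` is hit by the
  letter pair `(P₁, P₁)` only);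
* `wLawTwo_posRoots_le_six_of_det_middle_eq_zero` — **every `2 × 2` W-configuration whose MIDDLE letter `P₁` (the PSD letter next to
  the pivot from below) is singular (`det P₁ = 0`, i.e. rank `≤ 1`) has at most `6 = 3·2` distinct positive roots**, in every chamber:
  off the chamber by the chamber law; inside it the two lowest pivot degrees `e + d₂ < e + d₁` are separated only by `2d₁`, whose
  coefficient `det P₁` vanishes, so the clustered negative budget `signVariations_pair_budget` (val-sym-mdr-p1 g4) gives
  `Var ≤ 2·4 − 2 = 6`.  The witness is in this class and attains `6`: the class is settled with its sharp constant.
* `wLawTwo_posRoots_le_six_unless_core` — bookkeeping union of the three laws: a seventh positive root of a `2 × 2` W-pencil needs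
  the chamber AND the sign cell AND `det P₁ > 0` (a rank-two middle letter).

By the LEVER (`WLawTwoSignCell.lever` with `A = P₁`: `det P₁ · mix(P₂,Q) ≤ mix(P₁,P₂) · mix(P₁,Q)`) the remaining core is the regime where
`det P₁` is positive but controlled by the cross terms; nothing here decides it (signs allow `8`, located `≤ 6`).  Nothing bears on `WLaw`
for `n ≥ 3`, on `MatrixDescartes` / `stub_twoSided` in its window, on `DoorA26` / `DoorA34`, registers, or `VP ≠ VNP`.

[folklore] Descartes' rule of signs with a clustered negative budget (tree), coefficient bookkeeping of `2 × 2` pencils; no source.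
-/

-- `Summit.ValiantsHypothesis.ValiantsHypothesis.…` repeats a component by the D-0017 layout
-- (single-conjunct summit), which the `dupNamespace` linter flags; the name is mandated.
set_option linter.dupNamespace false

namespace Summit.ValiantsHypothesis.ValiantsHypothesis.Theorems.LacunarySymmetroidMatrixDescartes

open Polynomial Finset
open scoped BigOperators

namespace WLawTwoRankOneMiddle

open Pivot.TwoDescartes (letter expo agg coeff_det agg_eq_zero pencil_eq_sum)
open WLawTwoChambers (coeff_det_eq_zero_of_forall_ne wPencil_eq wPencil_posRoots_eq wPencil_neg_mem card_pivotDegrees_le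
  expo_w_cases signVariations_pair_budget card_posRoots_le_signVariations wLawTwo_posRoots_le_six_of_not_chamber)

variable {e d₁ d₂ d₃ : ℕ} {J P₁ P₂ Q : Matrix (Fin 2) (Fin 2) ℝ}

/-- The aggregated letter of the W-pencil at the exponent `d₁` is `P₁` (the exponents `d₂ < d₁ < e < d₃` are distinct). -/
theorem agg_d₁ (h₂₁ : d₂ < d₁) (h₁ₑ : d₁ < e) (hₑ₃ : e < d₃) :
    agg e ![d₁, d₂, d₃] J ![P₁, P₂, Q] d₁ = P₁ := by
  unfold agg
  rw [Fintype.sum_option, Fin.sum_univ_three]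
  have h0 : (if expo e ![d₁, d₂, d₃] none = d₁ then letter J ![P₁, P₂, Q] none else 0) = 0 :=
    if_neg (fun h => absurd (show e = d₁ from h) (by omega))
  have h1 : (if expo e ![d₁, d₂, d₃] (some 0) = d₁ then letter J ![P₁, P₂, Q] (some 0) else 0) = P₁ :=
    if_pos (by simp [expo])
  have h2 : (if expo e ![d₁, d₂, d₃] (some 1) = d₁ then letter J ![P₁, P₂, Q] (some 1) else 0) = 0 :=
    if_neg (fun h => absurd (show d₂ = d₁ by simpa [expo] using h) (by omega))
  have h3 : (if expo e ![d₁, d₂, d₃] (some 2) = d₁ then letter J ![P₁, P₂, Q] (some 2) else 0) = 0 :=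
    if_neg (fun h => absurd (show d₃ = d₁ by simpa [expo] using h) (by omega))
  rw [h0, h1, h2, h3]
  simp

/-- **Inside the chamber the coefficient of `X^{2d₁}` is `det P₁`**: the degree `2d₁` is the sum of two letter exponents only as
`d₁ + d₁` (this uses `e + d₂ ≠ 2d₁`, part of the chamber condition, and `d₂ + d₃ ≠ 2d₁`, automatic there). -/
theorem coeff_two_d₁ (h₂₁ : d₂ < d₁) (h₁ₑ : d₁ < e) (hₑ₃ : e < d₃) (hch₁ : e + d₂ ≠ 2 * d₁) (hch₂ : d₂ + d₃ ≠ 2 * d₁) :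
    (Matrix.det (∑ l, ((X : ℝ[X]) ^ expo e ![d₁, d₂, d₃] l) • (letter J ![P₁, P₂, Q] l).map Polynomial.C)).coeff (d₁ + d₁)
      = P₁.det := by
  rw [coeff_det]
  rw [Finset.sum_eq_single (d₁, d₁)]
  · simp only
    rw [agg_d₁ h₂₁ h₁ₑ hₑ₃, Matrix.det_fin_two]
  · -- every other pair of the antidiagonal has a vanishing aggregated letter
    rintro ⟨a, b⟩ hab hne
    have hab' : a + b = d₁ + d₁ := by simpa using hab
    simp only
    by_cases ha : ∃ l, expo e ![d₁, d₂, d₃] l = a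
    · obtain ⟨l, hl⟩ := ha
      have hb : ∀ l', expo e ![d₁, d₂, d₃] l' ≠ b := by
        intro l' hl'
        rcases expo_w_cases (e := e) (d₁ := d₁) (d₂ := d₂) (d₃ := d₃) l with h | h | h | h <;>
          rcases expo_w_cases (e := e) (d₁ := d₁) (d₂ := d₂) (d₃ := d₃) l' with h' | h' | h' | h' <;>
          rw [h] at hl <;> rw [h'] at hl' <;>
          first
            | omega
            | exact hne (Prod.ext hl.symm hl'.symm)
      rw [agg_eq_zero e _ J _ b hb]
      simp
    · push Not at ha
      rw [agg_eq_zero e _ J _ a ha]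
      simp
  · intro h
    exact absurd (by simp) h

/-- **W-LAW FOR A RANK-ONE MIDDLE LETTER.**  A `2 × 2` W-configuration `X^e J + X^{d₁} P₁ + X^{d₂} P₂ + X^{d₃} Q`
(`d₂ < d₁ < e < d₃`; `J` any real matrix; `P₁, P₂, Q ⪰ 0`) with `det P₁ = 0` has at most `6 = 3·2` distinct positive roots of its
determinant — in every exponent chamber.  The tree's six-root witness (`P₁ = v vᵀ`) is in this class: sharp. -/
theorem wLawTwo_posRoots_le_six_of_det_middle_eq_zero (hP₁ : P₁.PosSemidef) (hP₂ : P₂.PosSemidef) (hQ : Q.PosSemidef)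
    (h₂₁ : d₂ < d₁) (h₁ₑ : d₁ < e) (hₑ₃ : e < d₃) (hA : P₁.det = 0) :
    ((Matrix.det (((X : ℝ[X]) ^ e) • J.map Polynomial.C + ((X : ℝ[X]) ^ d₁) • P₁.map Polynomial.C
        + ((X : ℝ[X]) ^ d₂) • P₂.map Polynomial.C + ((X : ℝ[X]) ^ d₃) • Q.map Polynomial.C)).roots.toFinset.filter
          (fun t => 0 < t)).card ≤ 6 := by
  by_cases hch : e + d₂ < 2 * d₁ ∧ d₁ + e < d₂ + d₃ ∧ d₂ + d₃ < 2 * e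
  swap
  · exact wLawTwo_posRoots_le_six_of_not_chamber hP₁ hP₂ hQ h₂₁ h₁ₑ hₑ₃ hch
  obtain ⟨hc₁, hc₂, hc₃⟩ := hch
  rw [wPencil_posRoots_eq]
  set F := Matrix.det (∑ l, ((X : ℝ[X]) ^ expo e ![d₁, d₂, d₃] l) • (letter J ![P₁, P₂, Q] l).map Polynomial.C)
    with hF
  have hT : ∀ n, F.coeff n < 0 → n ∈ ({e + d₂, e + d₁, e + e, e + d₃} : Finset ℕ) :=
    fun n hn => wPencil_neg_mem hP₁ hP₂ hQ n hn
  have hmem : ∀ w, w = e + d₂ ∨ w = e + d₁ ∨ w = e + e ∨ w = e + d₃ →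
      w ∈ ({e + d₂, e + d₁, e + e, e + d₃} : Finset ℕ) := by
    intro w hw
    simp only [Finset.mem_insert, Finset.mem_singleton]
    tauto
  -- the gap `(e + d₂, e + d₁)` carries only the degree `2d₁`, whose coefficient is `det P₁ = 0`
  have hgap : ∀ m, e + d₂ < m → m < e + d₁ → F.coeff m = 0 := by
    intro m hm₁ hm₂
    by_cases hm : m = d₁ + d₁
    · rw [hm, hF, coeff_two_d₁ h₂₁ h₁ₑ hₑ₃ (by omega) (by omega), hA]
    · refine coeff_det_eq_zero_of_forall_ne e _ J _ m fun l l' hll' => ?_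
      rcases expo_w_cases (e := e) (d₁ := d₁) (d₂ := d₂) (d₃ := d₃) l with h | h | h | h <;>
        rcases expo_w_cases (e := e) (d₁ := d₁) (d₂ := d₂) (d₃ := d₃) l' with h' | h' | h' | h' <;>
        rw [h, h'] at hll' <;> omega
  have h1 := signVariations_pair_budget F _ hT (e + d₂) (e + d₁) (by omega) (hmem _ (Or.inl rfl))
    (hmem _ (Or.inr (Or.inl rfl))) hgap
  have h2 := card_posRoots_le_signVariations F
  have h3 := card_pivotDegrees_le e d₁ d₂ d₃
  omega

/-- **What a seventh root needs (bookkeeping union of the three `n = 2` laws).**  A `2 × 2` W-configuration has `Z₊ ≤ 6 = 3·2`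
unless simultaneously: the exponents lie in the chamber `e + d₂ < 2d₁ ∧ d₁ + e < d₂ + d₃ ∧ d₂ + d₃ < 2e`, the letters lie in the sign
cell `det J < 0 ∧ mix(J,P₁) < 0 ∧ mix(J,P₂) < 0 ∧ mix(J,Q) < 0`, and the middle letter has rank two (`0 < det P₁`). -/
theorem wLawTwo_posRoots_le_six_unless_core (hJ : J.IsSymm) (hP₁ : P₁.PosSemidef) (hP₂ : P₂.PosSemidef)
    (hQ : Q.PosSemidef) (h₂₁ : d₂ < d₁) (h₁ₑ : d₁ < e) (hₑ₃ : e < d₃)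
    (h : ¬ ((e + d₂ < 2 * d₁ ∧ d₁ + e < d₂ + d₃ ∧ d₂ + d₃ < 2 * e) ∧
      (J.det < 0 ∧ J 0 0 * P₁ 1 1 + J 1 1 * P₁ 0 0 - 2 * (J 0 1 * P₁ 0 1) < 0
        ∧ J 0 0 * P₂ 1 1 + J 1 1 * P₂ 0 0 - 2 * (J 0 1 * P₂ 0 1) < 0
        ∧ J 0 0 * Q 1 1 + J 1 1 * Q 0 0 - 2 * (J 0 1 * Q 0 1) < 0) ∧ 0 < P₁.det)) :
    ((Matrix.det (((X : ℝ[X]) ^ e) • J.map Polynomial.C + ((X : ℝ[X]) ^ d₁) • P₁.map Polynomial.C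
        + ((X : ℝ[X]) ^ d₂) • P₂.map Polynomial.C + ((X : ℝ[X]) ^ d₃) • Q.map Polynomial.C)).roots.toFinset.filter
          (fun t => 0 < t)).card ≤ 6 := by
  by_cases hA : P₁.det = 0
  · exact wLawTwo_posRoots_le_six_of_det_middle_eq_zero hP₁ hP₂ hQ h₂₁ h₁ₑ hₑ₃ hA
  · have hApos : 0 < P₁.det := lt_of_le_of_ne hP₁.det_nonneg (Ne.symm hA)
    refine WLawTwoSignCell.wLawTwo_posRoots_le_six_unless_hardCell hJ hP₁ hP₂ hQ h₂₁ h₁ₑ hₑ₃ fun hh => h ?_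
    exact ⟨hh.1, hh.2, hApos⟩

end WLawTwoRankOneMiddle

end Summit.ValiantsHypothesis.ValiantsHypothesis.Theorems.LacunarySymmetroidMatrixDescartes
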